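import Summits.BirchSwinnertonDyer.Rank1Residual.Additive.X4RankZeroTamagawaParity
import Summits.BirchSwinnertonDyer.Rank1Residual.AdditivePotMult.ManinConstantDegree
import Summits.BirchSwinnertonDyer.Rank1Residual.GaloisImage.PotMultLargeImage
import Summits.BirchSwinnertonDyer.Rank1Residual.X11b.MultiplicativeSurjectivityTwist
import HarnessLib

/-!
# X4(M), rank `0`, `p ≥ 5`: the Kim-2026 road (the lane's KCT row) MANIN-FREE — `p ∤ deg φ` for any
# conductor-level parametrisation replaces `p ∤ c_D` (cell `b2b-bsdres`, sub-cell additive-p1, gen 18)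

HONEST FRAMING (cell `b2b-bsdres`, run/shared/lean/b2b/bsd-rank1-residual/, verbatim in every
file): the goal of the cell is to DELETE the COMBINATION-SHAPED residual classes of the
Birch–Swinnerton-Dyer formula for ALL analytic-rank `≤ 1` elliptic curves over `ℚ` — "full BSD
formula for every rank `≤ 1` curve in class `C`" assembled STRICTLY from published theorems — so
that the rank-`≤ 1` remainder becomes exactly the CONSTRUCTION-SHAPED classes, which are TYPED
(missing-input `Prop`s), NOT attempted. This is not "finishing BSD". X3♯(M)/X4(M) stay
CONSTRUCTION-SHAPED; per-pair consumers; nothing booked (the lane books, the referee signs).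
THEOREMS ONLY (no definition, no named fact, no `sorry`).

## What this file does

At `p ≥ 5` the rank-`0` X4 cells are booked through Kim, Amer. J. Math. 148 (2026) Thm. 1.8 (6)
(named fact `Kim2026.rankZero_padicValNat_sha_le_of_maninConstant`, consumer
`Additive.X4RankZero.bsdp_of_shaAn_unit`; lane row KCT), whose Manin binder `p ∤ c_D` is met by the
Cremona optimality datum — and graded LITERAL `MANIN-DB@p` where the optimal curve is undetermined
(RESIDUAL-MAP §E addendum: "on X4(M)/X3(M) rank-0 rows the `MANIN-DB@p` literal tier of KCT … STAYS
literal … no Manin-free (M) kernel in the tree"). On (M) there IS one since gen 14: additive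
potentially multiplicative reduction is TAME at every odd `p` (`f_p = 2`, `PotMult.condExpTwo_of_odd`),
so Česnavičius–Neururer–Saha 2024 Thm. 1.2 (`hCNS` = A159) gives `p ∤ deg φ ⟹ p ∤ c` for ANY
conductor-level parametrisation (`ClassX4M.not_dvd_maninConstant_of_not_dvd_modularDegree`; no
optimality). This file threads that lever into the Kim-2026 consumers (all `p ≥ 5`, X4(M)):

* `ClassX4M.missingUpperBoundAt_rankZero_of_kim_of_not_dvd_modularDegree` — the typed UPPER half;
* `ClassX4M.bsdp_rankZero_of_kim_of_not_dvd_modularDegree_of_shaAn_unit` — `BSD(E,p)` on the unit rows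
  (`p ∤ ∏c_ℓ · #Ш_an`), with surj(p) as a bit, or decided by `p ∤ ord_p j` (`…_of_not_dvd_padicValRat_j_…`),
  or automatic at `p ≥ 11` (`…_of_eleven_le_…`, BDMTV 2019 `hB`);
* `ClassX4M.bsdp_rankZero_of_kim_of_casselsTate_of_not_sq_dvd_tamagawaProduct_of_not_dvd_modularDegree` —
  the Tamagawa-defect-`1` parity closure (`X4RankZero.bsdp_of_casselsTate_of_not_sq_dvd_tamagawaProduct`)
  Manin-free;
* `ClassX4M.bsdp_rankZero_of_kim_of_lower_of_not_dvd_modularDegree` — `BSD(E,p)` from the LOWER half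
  alone on the `p ∣ #Ш_an` rows, and `…_of_casselsTate_of_pow_dvd_…` (one descent certificate).

Per pair (binders: `r_an = 0`, surj / `p ∤ ord_p j` / `p ≥ 11`, `p ∤ ∏c_ℓ` (or `p² ∤`), `p ∤ deg φ`
for a conductor-level datum, `#Ш_an` datum); NOT a class theorem; nothing booked. Census pointer
(EVIDENCE, RESIDUAL-MAP §E PMX α pre-count): ≈ 704 X4(M) classes carry `MANIN-DB@p` beside the PMX /
KCT families; Cremona's `alldegphi` is exact per class.

References: Kim 2026 [Kim2022StructureSelmer] Thm. 1.8 (6); Česnavičius–Neururer–Saha 2024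
[CesnaviciusNeururerSaha2023] Thm. 1.2; BDMTV 2019 [BalakrishnanEtAl2019] Thm. 1.2; Silverman
*ATAEC* V.5.3 / V.6.1, *AEC* X.4.14; Miller 2011 [Miller2011LMS] Def. 1.1.
-/

noncomputable section

open scoped Classical

open WeierstrassCurve Literature.NumberTheory.EllipticCurves
  Literature.NumberTheory.EllipticCurves.ModularForms
  Literature.NumberTheory.EllipticCurves.Rank1Residual
  Literature.NumberTheory.EllipticCurves.Rank1Residual.Typed
  Literature.NumberTheory.EllipticCurves.BalakrishnanEtAl2019

namespace Summit.BirchSwinnertonDyer.Rank1Residual.AdditivePotMult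

section ClassX4M

open Additive GaloisImage

variable {W : WeierstrassCurve ℚ} [W.IsElliptic] [W.IsGloballyMinimal] {p : ℕ} [hp : Fact p.Prime]

/-- **X4(M) ∧ surj(p) ∧ `r_an = 0`, `p ≥ 5`: the typed UPPER half `MissingUpperBoundAt W p` from
Kim 2026 Thm. 1.8 (6) with the Manin binder met by `p ∤ deg φ`** for ANY conductor-level
parametrisation `D` (CNS Thm. 1.2 `hCNS` + tameness of (M)); `p ∤ ∏c_ℓ`. Named facts `hKim`, `hCNS`,
`hGZK`, `hmod`. [cite: Kim2022StructureSelmer, Thm. 1.9 (6) (PDF p. 8)] [cite: CesnaviciusNeururerSaha2023, Thm. 1.2]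
[cite: Miller2011LMS, Def. 1.1] -/
theorem ClassX4M.missingUpperBoundAt_rankZero_of_kim_of_not_dvd_modularDegree
    (hKim : Kim2026.rankZero_padicValNat_sha_le_of_maninConstant)
    (hCNS : cesnaviciusNeururerSaha_padicVal_maninConstant_le_modularDegree)
    (hGZK : rank_eq_analyticRank_of_analyticRank_le_one) (hmod : hasEntireLFunction_rat)
    (hp5 : 5 ≤ p) (hX : ClassX4M W p) (hsurj : Surj W p) (hr : W.analyticRank = 0)
    [NeZero (W.conductorNorm ℤ)] (D : ModularParametrizationData W (W.conductorNorm ℤ))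
    (hdeg : ¬ p ∣ D.modularDegree) (htam : ¬ p ∣ W.tamagawaProduct) : MissingUpperBoundAt W p :=
  X4RankZero.missingUpperBoundAt W p hKim hGZK hmod hp5 hr hX.classX4 hsurj D
    (ClassX4M.not_dvd_maninConstant_of_not_dvd_modularDegree hCNS D hX hdeg) htam

/-- **KCT Manin-free on X4(M): `BSD(E,p)` at `p ≥ 5` on X4(M) ∧ surj(p) ∧ `r_an = 0` with
`p ∤ ∏c_ℓ`, `p ∤ deg φ` (conductor-level datum) and `#Ш_an` a `p`-unit.**
[cite: Kim2022StructureSelmer, Thm. 1.9 (6) (PDF p. 8)] [cite: CesnaviciusNeururerSaha2023, Thm. 1.2]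
[cite: Miller2011LMS, §1 and Def. 1.1] -/
theorem ClassX4M.bsdp_rankZero_of_kim_of_not_dvd_modularDegree_of_shaAn_unit
    (hKim : Kim2026.rankZero_padicValNat_sha_le_of_maninConstant)
    (hCNS : cesnaviciusNeururerSaha_padicVal_maninConstant_le_modularDegree)
    (hGZK : rank_eq_analyticRank_of_analyticRank_le_one) (hmod : hasEntireLFunction_rat)
    (hp5 : 5 ≤ p) (hX : ClassX4M W p) (hsurj : Surj W p) (hr : W.analyticRank = 0)
    [NeZero (W.conductorNorm ℤ)] (D : ModularParametrizationData W (W.conductorNorm ℤ))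
    (hdeg : ¬ p ∣ D.modularDegree) (htam : ¬ p ∣ W.tamagawaProduct) {q : ℚ}
    (hq : shaAn W = (q : ℂ)) (hv : padicValRat p q = 0) : BSDp W p :=
  X4RankZero.bsdp_of_shaAn_unit W p hKim hGZK hmod hp5 hr hX.classX4 hsurj D
    (ClassX4M.not_dvd_maninConstant_of_not_dvd_modularDegree hCNS D hX hdeg) htam hq hv

/-- **Same, surj(p) decided by `p ∤ ord_p j(E)`** (très ramifié). [cite: Kim2022StructureSelmer, Thm. 1.9 (6) (PDF p. 8)]
[cite: SilvermanATAEC1994, V.6 Prop. 6.1 (p. 410) and V.5.3] [cite: Miller2011LMS, §1 and Def. 1.1] -/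
theorem ClassX4M.bsdp_rankZero_of_kim_of_not_dvd_padicValRat_j_of_not_dvd_modularDegree_of_shaAn_unit
    (hKim : Kim2026.rankZero_padicValNat_sha_le_of_maninConstant)
    (hCNS : cesnaviciusNeururerSaha_padicVal_maninConstant_le_modularDegree)
    (hGZK : rank_eq_analyticRank_of_analyticRank_le_one) (hmod : hasEntireLFunction_rat)
    (hp5 : 5 ≤ p) (hX : ClassX4M W p) (hj : ¬ (p : ℤ) ∣ padicValRat p W.j) (hr : W.analyticRank = 0)
    [NeZero (W.conductorNorm ℤ)] (D : ModularParametrizationData W (W.conductorNorm ℤ))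
    (hdeg : ¬ p ∣ D.modularDegree) (htam : ¬ p ∣ W.tamagawaProduct) {q : ℚ}
    (hq : shaAn W = (q : ℂ)) (hv : padicValRat p q = 0) : BSDp W p :=
  hX.bsdp_rankZero_of_kim_of_not_dvd_modularDegree_of_shaAn_unit hKim hCNS hGZK hmod hp5
    (ClassX4M.surj_of_not_dvd_padicValRat_j hX hj) hr D hdeg htam hq hv

/-- **Same at `p ≥ 11`, NO image bit** (X4(M) is surjective at `p ≥ 11`: BDMTV 2019 `hB`,
`ClassX4M.surj_of_eleven_le`). [cite: Kim2022StructureSelmer, Thm. 1.9 (6) (PDF p. 8)]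
[cite: BalakrishnanEtAl2019, §1 Thm. 1.2 (arXiv:1711.05846 p. 2)] [cite: Miller2011LMS, §1 and Def. 1.1] -/
theorem ClassX4M.bsdp_rankZero_of_kim_of_eleven_le_of_not_dvd_modularDegree_of_shaAn_unit
    (hKim : Kim2026.rankZero_padicValNat_sha_le_of_maninConstant)
    (hCNS : cesnaviciusNeururerSaha_padicVal_maninConstant_le_modularDegree)
    (hB : thm12_not_le_normalizer_splitCartan)
    (hGZK : rank_eq_analyticRank_of_analyticRank_le_one) (hmod : hasEntireLFunction_rat)
    (h11 : 11 ≤ p) (hX : ClassX4M W p) (hr : W.analyticRank = 0)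
    [NeZero (W.conductorNorm ℤ)] (D : ModularParametrizationData W (W.conductorNorm ℤ))
    (hdeg : ¬ p ∣ D.modularDegree) (htam : ¬ p ∣ W.tamagawaProduct) {q : ℚ}
    (hq : shaAn W = (q : ℂ)) (hv : padicValRat p q = 0) : BSDp W p :=
  hX.bsdp_rankZero_of_kim_of_not_dvd_modularDegree_of_shaAn_unit hKim hCNS hGZK hmod (by omega)
    (ClassX4M.surj_of_eleven_le hB hX h11) hr D hdeg htam hq hv

/-- **Tamagawa-defect-`1` parity, Manin-free, on X4(M)**: `p ≥ 5`, surj(p), `r_an = 0`, `p² ∤ ∏c_ℓ`,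
`p ∤ deg φ`, `#Ш_an` a `p`-unit ⟹ `BSD(E,p)` (Kim's inequality + Cassels–Tate squareness,
`X4RankZero.bsdp_of_casselsTate_of_not_sq_dvd_tamagawaProduct`). [cite: Kim2022StructureSelmer, Thm. 1.9 (6) (PDF p. 8)]
[cite: SilvermanAEC2009, Thm. X.4.14] [cite: CesnaviciusNeururerSaha2023, Thm. 1.2] [cite: Miller2011LMS, §1 and Def. 1.1] -/
theorem ClassX4M.bsdp_rankZero_of_kim_of_casselsTate_of_not_sq_dvd_tamagawaProduct_of_not_dvd_modularDegree
    (hCT : exists_casselsTate_pairing (K := ℚ))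
    (hKim : Kim2026.rankZero_padicValNat_sha_le_of_maninConstant)
    (hCNS : cesnaviciusNeururerSaha_padicVal_maninConstant_le_modularDegree)
    (hGZK : rank_eq_analyticRank_of_analyticRank_le_one) (hmod : hasEntireLFunction_rat)
    (hp5 : 5 ≤ p) (hX : ClassX4M W p) (hsurj : Surj W p) (hr : W.analyticRank = 0)
    [NeZero (W.conductorNorm ℤ)] (D : ModularParametrizationData W (W.conductorNorm ℤ))
    (hdeg : ¬ p ∣ D.modularDegree) (htam : ¬ p ^ 2 ∣ W.tamagawaProduct) {q : ℚ}
    (hq : shaAn W = (q : ℂ)) (hv : padicValRat p q = 0) : BSDp W p :=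
  X4RankZero.bsdp_of_casselsTate_of_not_sq_dvd_tamagawaProduct W p hCT hKim hGZK hmod hp5 hr
    hX.classX4 hsurj D (ClassX4M.not_dvd_maninConstant_of_not_dvd_modularDegree hCNS D hX hdeg) htam hq
    hv

/-- **`BSD(E,p)` on X4(M) ∧ surj(p) ∧ `r_an = 0` at `p ≥ 5` from the LOWER half alone, Manin-free**
(`p ∤ ∏c_ℓ`, `p ∤ deg φ`). [cite: Kim2022StructureSelmer, Thm. 1.9 (6) (PDF p. 8)] [cite: CesnaviciusNeururerSaha2023, Thm. 1.2]
[cite: Miller2011LMS, §1 and Def. 1.1] -/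
theorem ClassX4M.bsdp_rankZero_of_kim_of_lower_of_not_dvd_modularDegree
    (hKim : Kim2026.rankZero_padicValNat_sha_le_of_maninConstant)
    (hCNS : cesnaviciusNeururerSaha_padicVal_maninConstant_le_modularDegree)
    (hGZK : rank_eq_analyticRank_of_analyticRank_le_one) (hmod : hasEntireLFunction_rat)
    (hp5 : 5 ≤ p) (hX : ClassX4M W p) (hsurj : Surj W p) (hr : W.analyticRank = 0)
    [NeZero (W.conductorNorm ℤ)] (D : ModularParametrizationData W (W.conductorNorm ℤ))
    (hdeg : ¬ p ∣ D.modularDegree) (htam : ¬ p ∣ W.tamagawaProduct)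
    (hlow : MissingLowerBoundAt W p) : BSDp W p :=
  X4RankZero.bsdp_of_missingLowerBoundAt W p hKim hGZK hmod hp5 hr hX.classX4 hsurj D
    (ClassX4M.not_dvd_maninConstant_of_not_dvd_modularDegree hCNS D hX hdeg) htam hlow

/-- **The `p ∣ #Ш_an` rows with ONE descent certificate, Manin-free**: X4(M) ∧ surj(p) ∧ `r_an = 0`,
`p ≥ 5`, `p ∤ ∏c_ℓ`, `p ∤ deg φ`, `ord_p #Ш_an ≤ 2k`, `p^{2k−1} ∣ #Ш(E)` ⟹ `BSD(E,p)` (lower half by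
Cassels–Tate squareness on the certificate). [cite: Kim2022StructureSelmer, Thm. 1.9 (6) (PDF p. 8)]
[cite: SilvermanAEC2009, Thm. X.4.14] [cite: Miller2011LMS, §1 and Def. 1.1] -/
theorem ClassX4M.bsdp_rankZero_of_kim_of_casselsTate_of_pow_dvd_of_not_dvd_modularDegree
    (hCT : exists_casselsTate_pairing (K := ℚ))
    (hKim : Kim2026.rankZero_padicValNat_sha_le_of_maninConstant)
    (hCNS : cesnaviciusNeururerSaha_padicVal_maninConstant_le_modularDegree)
    (hGZK : rank_eq_analyticRank_of_analyticRank_le_one) (hmod : hasEntireLFunction_rat)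
    (hp5 : 5 ≤ p) (hX : ClassX4M W p) (hsurj : Surj W p) (hr : W.analyticRank = 0)
    [NeZero (W.conductorNorm ℤ)] (D : ModularParametrizationData W (W.conductorNorm ℤ))
    (hdeg : ¬ p ∣ D.modularDegree) (htam : ¬ p ∣ W.tamagawaProduct) {q : ℚ}
    (hq : shaAn W = (q : ℂ)) {k : ℕ} (hv : padicValRat p q ≤ 2 * k)
    (hdvd : p ^ (2 * k - 1) ∣ W.shaOrder) : BSDp W p :=
  hX.bsdp_rankZero_of_kim_of_lower_of_not_dvd_modularDegree hKim hCNS hGZK hmod hp5 hsurj hr D hdeg htam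
    (missingLowerBoundAt_of_casselsTate_of_pow_dvd W p hCT (hGZK W (by rw [hr]; exact zero_le_one)).2
      hq hv hdvd)

end ClassX4M

end Summit.BirchSwinnertonDyer.Rank1Residual.AdditivePotMult

end
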